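import Summits.AtomisticToContinuum.FouriersLaw.Theses.EmbeddedDrudeMourre
import Summits.AtomisticToContinuum.FouriersLaw.Theorems.FGRGap.Negative.LoadBearing
import Summits.AtomisticToContinuum.FouriersLaw.Theorems.FGRGap.Negative.OnsiteReduction

/-!
# Line `chord-quartic-abel` for crux `FGRGap` (item stmt-AtomisticToContinuum-12595)

Crux (route EmbeddedDrudeMourre, rank 3; FIXED, never restated):
`FGRGap := ∀ ω₂ a b, 0 < ω₂ → 0 < a → 0 < b → PhononBoltzmann.HasOddSectorGap ω₂ a b`
(odd-sector gap of ALS's linearised 2↔2 phonon-Boltzmann Dirichlet form `q` of the pinned band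
`ω(k)² = ω₂ + 2(1 - cos k)`, vertex `Φ = a + 16b ∏ sin(k_j/2)`).

Idea card `Cruxes/FGRGap/Ideas/chord-quartic-abel.md` (crux-ideate r1 ideator 2; triage r1: pass ×3).
LEVER: the phonon point `P(k) = (ω(k), sin k)` lies on the tacnodal plane quartic
`C₄ : (X² - ω₂ - 2)² + 4Y² = 4` (canonical model of the phonon elliptic curve; `phononPoint_mem_quartic`
below), and a NON-TRIVIAL 2↔2 resonance `(k₁,k₂) → (k₃,k₄)` holds iff `P(k₁), P(k₂), -P(k₃), -P(k₄)` are
COLLINEAR (energy = vanishing `X³`-coefficient of a line section, momentum = Abel's theorem for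
`dk = dz/iz`). Hence the resonance 4-web (the four foliations `{k_i = const}` of the 2-dimensional
resonant surface) is the chord web of `C₄`; by Abel's theorem for its three regular differentials
`⟨dk, dω, du := dk/ω⟩` and Bol's rank bound `π(2,4) = 3` its abelian relations on any piece in general
position are EXACTLY `span{(k,k,-k,-k), (ω,ω,-ω,-ω), (u,u,u,u)} ⊕ constants`; the elliptic logarithm
`u = ∫₀ᵏ dk'/ω` enters with the bosonic sign pattern `(+,+,+,+)` (an ANTI-invariant), so chartwise every
smooth collisional invariant is `αk + βω ± γu + c`; overlapping slot projections of near-grazing charts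
force `γ = 0`, `2π`-periodicity (one umklapp) forces `α = 0`: smooth invariants are `c + dω`, hence no odd
one — half (a) of the crux for EVERY `ω₂ > 0`, even sector included. Half (b) (coercivity given no odd null
vector) is the shared Weyl stub (Lukkarinen's truncated `V' - K'` + compactness), where `0 < a` enters.

SKELETON (6 registered stubs + the kernel-checked composition `FGRGap_of`; general position of a
resonance := `0 < velocityGap` = the four group velocities pairwise distinct = pairwise transversality
of the four foliations, computed: `dk₂ ∥ dk₁ ⇔ v₃ = v₄`, `dk₂ ∥ dk₃ ⇔ v₁ = v₄`, `dk₄ ∥ dk₁ ⇔ v₂ = v₃`,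
`dk₄ ∥ dk₃ ⇔ v₁ = v₂`, `dk₂ ∥ dk₄ ⇔ v₁ = v₃`, chart `∂₂Ω ≠ 0 ⇔ v₂ ≠ v₄`):
* `stub_resonanceIsChord`       — S1, algebra (M): non-trivial resonance ⇒ `det3 (P₁) (P₂) (-P₃) = 0`.
* `stub_antiInvariant_of_chord` — S2, calculus (M): S1 ⇒ on every general-position chart `(U, h)` of the
  resonant surface `u(k₁) + u(k₂) + u(k₃) + u(k₄)` is CONSTANT (chain rule; `∂₁h, ∂₃h` are ratios of
  velocity differences; zero gradient ⇔ collinearity of the projective images `(v_i, ±1/ω_i)` of the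
  four phonon points under `(X,Y) ↦ (Y/X, 1/X)`).
* `stub_abelBolSpan`            — S3, web geometry (L): on a general-position chart carrying the
  anti-invariant, every SMOOTH abelian relation `g₁(k₁)+g₂(k₂)+g₃(k₃)+g₄(k₄) ≡ 0` lies in
  `span{R_k, R_ω, R_u} ⊕ constants` (Bol's bound rank ≤ 3 for a planar 4-web in general position +
  independence of `1, k, ω, u` on intervals; Abel explains, Bol proves).
* `stub_gluing`                 — S4, propagation (M/L): the chartwise span property ⇒ every smooth
  `2π`-periodic `ψ` satisfying the invariant identity at all general-position resonances is `c + dω`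
  (near-grazing charts by the IFT at `k₂ = k*`, `v'(k*) ≠ 0`; slot-1/slot-3 projections overlap ⇒ `γ = 0`;
  projections cover `𝕋` up to finitely many points ⇒ one `(α, β)`; periodicity ⇒ `α = 0`). This is where
  `hasOddSectorGap_false_without_periodic` (witness `k ↦ k` = `R_k`!) is honoured.
* `stub_bootstrap`              — S5, regularity (L): `0 < ω₂`, `0 < a`, `0 ≤ b`: an `L²` periodic null
  vector of `q` is a.e. a smooth periodic function invariant at all general-position resonances
  (LS08 §5 averaging; the submersion conditions of the averaging maps ARE the velocity inequalities).
* `stub_weylReduction`          — S6, coercivity (L/XL): `0 < ω₂`, `0 < a`, `0 ≤ b`: no odd periodic `L²`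
  null vector of `q` ⇒ `HasOddSectorGap` (minimising sequence, `q ≥ q_ε = V_ε - K_ε` with all kernels
  bounded on `{velocityGap ≥ ε}`, `V_ε ≥ v₀(ε,a) > 0` — uses `0 < a`: at `a = 0` the fibre `k = 0` is
  dead, the disprover's near-miss `not_hasOddSectorGap_zero_onsite` —, `K_ε` Hilbert–Schmidt, weak limit
  non-zero, `q = sup_ε q_ε` by monotone convergence). Verbatim the shape `GapOfNoOddNullVector` agreed by
  the triage panel; shareable with the jet lines.
* `FGRGap_of` — sorry-free: S6 ∘ [S5, S4 ∘ (S3 ∘ S2 ∘ S1), oddness glue (`f` odd, `f =ᵐ ψ`, `ψ`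
  continuous ⇒ `ψ` odd; `ψ = c + dω` even ⇒ `ψ ≡ 0` ⇒ `‖f‖² = 0`)].

Disproof.lean (cdisprove gen 2 c1) honoured: `_false_without_periodic` at S4 (α = 0) and S5/S6
(periodic hypotheses); `_false_without_odd` in `FGRGap_of` (the classification DOES produce the even null
vectors `1, ω`; oddness kills them); `crux_false_without_omegaPos` — `0 < ω₂` is a hypothesis of every stub
(`c = ω₂ + 2 > 2`: two smooth real ovals; `u' = 1/ω`; analytic band for the IFT charts; `ω ≥ √ω₂` in the
kernel bounds); `crux_false_without_couplings` / near-miss `not_hasOddSectorGap_zero_onsite` — `0 < a` is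
used at S6 only, `0 < b` nowhere (`0 ≤ b`), matching `onsite_of_crux`; `no_uniform_gap` — the gap constant
lives inside `HasOddSectorGap ω₂ a b`, nothing uniform is claimed. No stub is an instance refuted by the
landed `Theorems/FGRGap/Negative/{LoadBearing, OnsiteReduction}` (imported below; see the `example`s at the
end).
-/

noncomputable section

open MeasureTheory Set Real Filter Topology
open scoped ENNReal
open Literature.MathematicalPhysics.KineticTheory.PhononBoltzmann

namespace Summit.AtomisticToContinuum.FouriersLaw.Cruxes.FGRGap.ChordQuarticAbel

/-! ## Objects of the line (definitions only; no axioms) -/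

/-- The phonon point `P(k) = (ω(k), sin k)`; it lies on the tacnodal quartic
`(X² - ω₂ - 2)² + 4Y² = 4` (`phononPoint_mem_quartic`), `(X, Y) ↦ z = (ω₂ + 2 - X²)/2 + iY = e^{ik}`. -/
def phononPoint (ω₂ k : ℝ) : ℝ × ℝ :=
  (dispersion ω₂ k, Real.sin k)

/-- Twice the signed area of the triangle `p q r` in `ℝ²` (zero iff the three points are collinear). -/
def det3 (p q r : ℝ × ℝ) : ℝ :=
  (q.1 - p.1) * (r.2 - p.2) - (q.2 - p.2) * (r.1 - p.1)

/-- `P(k) ∈ C₄`: `(ω² - ω₂ - 2)² + 4 sin² k = 4 cos² k + 4 sin² k = 4`. [folklore] -/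
theorem phononPoint_mem_quartic {ω₂ : ℝ} (hω : 0 ≤ ω₂) (k : ℝ) :
    ((phononPoint ω₂ k).1 ^ 2 - (ω₂ + 2)) ^ 2 + 4 * (phononPoint ω₂ k).2 ^ 2 = 4 := by
  have h := Real.sin_sq_add_cos_sq k
  simp only [phononPoint, dispersion_sq hω]
  linear_combination (4 : ℝ) * h

/-- The elliptic logarithm of the pinned band, `u(k) = ∫₀ᵏ dk'/ω(k')` (integral of the regular
differential `dk/ω` of `C₄`; strictly increasing, `u(k + 2π) = u(k) + u(2π)`, odd). -/
def ellipticLog (ω₂ k : ℝ) : ℝ :=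
  ∫ x in (0 : ℝ)..k, 1 / dispersion ω₂ x

/-- The VELOCITY GAP of a collision `(k₁, k₂) → (k₃, k₄ = k₁ + k₂ - k₃)`: the least of the six
differences `|v_i - v_j|` of group velocities. `0 < velocityGap` is GENERAL POSITION of the resonance
4-web at that point (pairwise transversality of the four foliations `{k_i = const}` of the resonant
surface, and `∂₂Ω = v₂ - v₄ ≠ 0`); it fails exactly on the six equal-velocity curves (grazing / fold /
exchange loci) and implies non-triviality (`k₃ ≢ k₁, k₂ mod 2π`). -/
def velocityGap (ω₂ k₁ k₂ k₃ : ℝ) : ℝ :=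
  min (min (min |groupVelocity ω₂ k₁ - groupVelocity ω₂ k₂| |groupVelocity ω₂ k₁ - groupVelocity ω₂ k₃|)
      (min |groupVelocity ω₂ k₁ - groupVelocity ω₂ (k₁ + k₂ - k₃)|
        |groupVelocity ω₂ k₂ - groupVelocity ω₂ k₃|))
    (min |groupVelocity ω₂ k₂ - groupVelocity ω₂ (k₁ + k₂ - k₃)|
      |groupVelocity ω₂ k₃ - groupVelocity ω₂ (k₁ + k₂ - k₃)|)

/-- A GENERAL-POSITION CHART of the resonant surface: an open preconnected `U ⊂ ℝ²` of pairs
`p = (k₁, k₃)` and a smooth branch `k₂ = h(k₁, k₃)` of resonant partners (`Ω(k₁, h, k₃) = 0`) along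
which all four group velocities stay pairwise distinct. (Such charts exist around every
general-position point of the non-perturbative branch by the implicit function theorem, `∂₂Ω = v₂ - v₄`.) -/
def IsResonanceChart (ω₂ : ℝ) (U : Set (ℝ × ℝ)) (h : ℝ × ℝ → ℝ) : Prop :=
  IsOpen U ∧ IsPreconnected U ∧ ContDiffOn ℝ (⊤ : ℕ∞) h U ∧
    (∀ p ∈ U, resonanceFn ω₂ p.1 (h p) p.2 = 0) ∧ (∀ p ∈ U, 0 < velocityGap ω₂ p.1 (h p) p.2)

namespace IsResonanceChart

variable {ω₂ : ℝ} {U : Set (ℝ × ℝ)} {h : ℝ × ℝ → ℝ}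

theorem isOpen (hc : IsResonanceChart ω₂ U h) : IsOpen U := hc.1

theorem isPreconnected (hc : IsResonanceChart ω₂ U h) : IsPreconnected U := hc.2.1

theorem contDiffOn (hc : IsResonanceChart ω₂ U h) : ContDiffOn ℝ (⊤ : ℕ∞) h U := hc.2.2.1

theorem resonant (hc : IsResonanceChart ω₂ U h) : ∀ p ∈ U, resonanceFn ω₂ p.1 (h p) p.2 = 0 :=
  hc.2.2.2.1

theorem generalPosition (hc : IsResonanceChart ω₂ U h) :
    ∀ p ∈ U, 0 < velocityGap ω₂ p.1 (h p) p.2 :=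
  hc.2.2.2.2

/-- Restriction of a chart to an open preconnected subset is a chart. -/
theorem mono (hc : IsResonanceChart ω₂ U h) {V : Set (ℝ × ℝ)} (hV : V ⊆ U) (hVo : IsOpen V)
    (hVc : IsPreconnected V) : IsResonanceChart ω₂ V h :=
  ⟨hVo, hVc, hc.contDiffOn.mono hV, fun p hp => hc.resonant p (hV hp),
    fun p hp => hc.generalPosition p (hV hp)⟩

end IsResonanceChart

/-! ## The six registered stubs (`sorry` lives ONLY here) -/

/-- **S1 · `stub_resonanceIsChord` — ResonanceIsChord** (algebraic half of the lever; size M).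
A non-trivial resonance `ω(k₁) + ω(k₂) = ω(k₃) + ω(k₁+k₂-k₃)` (`k₃ ≢ k₁`, `k₃ ≢ k₂ mod 2π`) makes the
phonon points `P(k₁), P(k₂), -P(k₃)` collinear (and, applying it to `(k₁, k₂, k₄)`, also `-P(k₄)`):
the line through `P(k₁), P(k₂)` meets `C₄` residually in two points `Q₃, Q₄` with `Σ X = 0` (no `X³`
term in a line section) and `∏ z = 1` (Vieta; `|z| = 1` is the curve equation), i.e. `(-Q₃, -Q₄)` is a
resonant out-pair with the same total momentum and energy, and the non-trivial out-pair is unique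
(unimodality of `s ↦ ω(P/2+s) + ω(P/2-s)` on `[0, π]`; the parity family `P = π` and the grazing limit =
lines through the origin are consistent special cases). Why plausibly true: polynomial identity +
uniqueness, numerically exact to `3e-13` at `ω₂ ∈ {0.1 … 48}` (three seats + num/sanity.py). Leans on:
`dispersion_sq`, `resonanceFn`, `Real.cos_eq_cos_iff`, `Polynomial` Vieta
(`Polynomial.Splits.coeff_zero_eq_prod_roots_of_monic`), the unique-non-trivial-root lemma (gen-1 evidence
FGRGapOddInvariant.lean: unimodality of `groupVelocity`). Honours `crux_false_without_omegaPos` (`0 < ω₂`: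
`c = ω₂ + 2 > 2`, two smooth real ovals). -/
theorem stub_resonanceIsChord :
    ∀ ω₂ : ℝ, 0 < ω₂ → ∀ k₁ k₂ k₃ : ℝ, resonanceFn ω₂ k₁ k₂ k₃ = 0 →
      (∀ n : ℤ, k₃ - k₁ ≠ 2 * π * n) → (∀ n : ℤ, k₃ - k₂ ≠ 2 * π * n) →
        det3 (phononPoint ω₂ k₁) (phononPoint ω₂ k₂) (-(phononPoint ω₂ k₃)) = 0 := by
  sorry

/-- **S2 · `stub_antiInvariant_of_chord` — the elliptic logarithm is an ANTI-invariant** (calculus half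
of the lever; size M). If the chord property S1 holds at `ω₂`, then along every general-position chart
`(U, h)` the sum `u(k₁) + u(h) + u(k₃) + u(k₁ + h - k₃)` is CONSTANT (sign pattern `(+,+,+,+)`, so `u` can
never be a collisional invariant). Proof sketch: `u' = 1/ω` (FTC, `ω > 0` continuous), `h ∈ C^∞(U)` with
`∂₁h = (v₄ - v₁)/(v₂ - v₄)`, `∂₃h = (v₃ - v₄)/(v₂ - v₄)` from differentiating `Ω(k₁, h, k₃) = 0`
(`hasDerivAt_resonanceFn`; `v₂ ≠ v₄` by general position); both partial derivatives of the sum vanish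
iff `(v₁, 1/ω₁), (v₂, 1/ω₂), (v₃, -1/ω₃), (v₄, -1/ω₄)` are collinear, which is S1 (at `(k₁,k₂,k₃)` and
`(k₁,k₂,k₄)`; non-triviality from `0 < velocityGap`) transported by the projective map
`(X, Y) ↦ (Y/X, 1/X)`; zero gradient on an open preconnected set ⇒ constant. Checked numerically to `1e-14`
(num/sanity.py). Leans on: `intervalIntegral.integral_hasDerivAt_right`, `hasDerivAt_dispersion`,
`hasDerivAt_resonanceFn`, `ContDiffOn.differentiableOn`, `IsPreconnected` + `IsOpen.is_const_of_fderiv_eq_zero`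
-type lemmas (`IsLocallyConstant`). -/
theorem stub_antiInvariant_of_chord :
    ∀ ω₂ : ℝ, 0 < ω₂ →
      (∀ k₁ k₂ k₃ : ℝ, resonanceFn ω₂ k₁ k₂ k₃ = 0 →
        (∀ n : ℤ, k₃ - k₁ ≠ 2 * π * n) → (∀ n : ℤ, k₃ - k₂ ≠ 2 * π * n) →
          det3 (phononPoint ω₂ k₁) (phononPoint ω₂ k₂) (-(phononPoint ω₂ k₃)) = 0) →
      ∀ (U : Set (ℝ × ℝ)) (h : ℝ × ℝ → ℝ), IsResonanceChart ω₂ U h →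
        ∃ C : ℝ, ∀ p ∈ U,
          ellipticLog ω₂ p.1 + ellipticLog ω₂ (h p) + ellipticLog ω₂ p.2 +
            ellipticLog ω₂ (p.1 + h p - p.2) = C := by
  sorry

/-- **S3 · `stub_abelBolSpan` — Abel–Bol span of the resonance 4-web** (the deep input; size L — no web
geometry in Mathlib). On a general-position chart `(U, h)` carrying the anti-invariant (S2), every SMOOTH
abelian relation `g₁(k₁) + g₂(k₂) + g₃(k₃) + g₄(k₄) = 0` (`k₂ = h`, `k₄ = k₁ + k₂ - k₃`) is a combination of
`R_k = (k, k, -k, -k)`, `R_ω = (ω, ω, -ω, -ω)`, `R_u = (u, u, u, u)` and constants. Proof sketch (Bol 1932 /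
Blaschke–Bol; Pereira–Pirio, An Invitation to Web Geometry, Ch. 2 Thm 2.8, Ch. 3 Thm 2.7–2.9; Hénaut 2004;
Griffiths 1976): at a point of `U` filter relations by vanishing order; the `j`-th graded piece injects into
`ker((c_i) ↦ Σ c_i (dk_i)^j ∈ Sʲ T*)`, of dimension `(3 - j)⁺` for four pairwise non-proportional covectors
`dk_i` (general position; Vandermonde for `j ≥ 3`) ⇒ rank ≤ 2 + 1 = 3 on the preconnected `U` (a relation
flat at a point vanishes near it: finite-type linear system / Hénaut's connection; elimination as for 3-webs);
`R_k, R_ω, R_u` ARE relations on `U` (momentum is built into `k₄`, energy is `resonant`, `R_u` is the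
hypothesis) and are independent (`1, k, ω, u` are linearly independent on every interval: differentiate,
`bω + c sin k + d` is analytic and vanishes at `0, π` only if `b = d = 0`), so they span. For THIS web the
bound can also be certified by the prolongation method at one point (finite linear algebra on Taylor
coefficients) — RUN numerically by this planner (num/prolong_svd.py, evidence-prolongation.md): at 8
general-position points, `ω₂ ∈ {0.05, 0.3, 1, 4, 25}`, jet orders `N = 5, 7, 8` (up to 44 equations × 32 unknowns)
the jet matrix has EXACTLY three null singular values (≤ 3e-8) and `σ₄ ≥ 5e-2` — no fourth relation to order 8, and
the jets of `R_k, R_ω, R_u` are null to 1e-10. Abel's theorem on the tacnodal quartic EXPLAINS the three relations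
(regular differentials `⟨1, X, Y⟩dX/F_Y = ⟨du, dk, dω⟩/8`); Bol's bound PROVES completeness. Why it might fail: only
through a hidden degeneracy of the web, excluded by `0 < velocityGap`. Leans on: `ContDiff`, `iteratedDeriv`,
`taylor_mean_remainder_lagrange`, `LinearIndependent`, `Module.finrank`. -/
theorem stub_abelBolSpan :
    ∀ ω₂ : ℝ, 0 < ω₂ → ∀ (U : Set (ℝ × ℝ)) (h : ℝ × ℝ → ℝ), IsResonanceChart ω₂ U h →
      (∃ C : ℝ, ∀ p ∈ U,
          ellipticLog ω₂ p.1 + ellipticLog ω₂ (h p) + ellipticLog ω₂ p.2 +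
            ellipticLog ω₂ (p.1 + h p - p.2) = C) →
      ∀ g₁ g₂ g₃ g₄ : ℝ → ℝ, ContDiff ℝ (⊤ : ℕ∞) g₁ → ContDiff ℝ (⊤ : ℕ∞) g₂ →
        ContDiff ℝ (⊤ : ℕ∞) g₃ → ContDiff ℝ (⊤ : ℕ∞) g₄ →
        (∀ p ∈ U, g₁ p.1 + g₂ (h p) + g₃ p.2 + g₄ (p.1 + h p - p.2) = 0) →
        ∃ α β γ c₁ c₂ c₃ c₄ : ℝ, ∀ p ∈ U,
          g₁ p.1 = α * p.1 + β * dispersion ω₂ p.1 + γ * ellipticLog ω₂ p.1 + c₁ ∧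
          g₂ (h p) = α * h p + β * dispersion ω₂ (h p) + γ * ellipticLog ω₂ (h p) + c₂ ∧
          g₃ p.2 = -(α * p.2) - β * dispersion ω₂ p.2 + γ * ellipticLog ω₂ p.2 + c₃ ∧
          g₄ (p.1 + h p - p.2) = -(α * (p.1 + h p - p.2)) - β * dispersion ω₂ (p.1 + h p - p.2) +
            γ * ellipticLog ω₂ (p.1 + h p - p.2) + c₄ := by
  sorry

/-- **S4 · `stub_gluing` — propagation / gluing** (size M/L; the step the triage panel corrected: the LOCAL
statement "invariant on a small piece ⇒ affine in ω" is FALSE — `αk + βω ± γu + c` IS a local invariant — so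
`γ = 0` and `α = 0` are global facts). If the chartwise span property (conclusion of S3, for every
general-position chart) holds at `ω₂`, then every smooth `2π`-periodic `ψ` satisfying the collision identity
at all GENERAL-POSITION resonances is `c + dω`. Proof sketch: for `k` outside a finite set (`±k_m`, where
`v' = 0`) the near-grazing branch `k₂(k, t)` of `Ω(k, k₂, k + t) = t·G = 0` is smooth by the IFT at `k₂ = k*`
(`∂G/∂k₂ = v'(k*) ≠ 0 ⇔ k ≠ ±k_m`), and small boxes `k ∈ I`, `t ∈ (t₀, t₁)` avoiding the six analytic
equal-velocity curves are general-position charts (none of the six identities holds on an open set near the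
diagonal: second-order terms `v'(k) ∓ v'(k*) ≠ 0`); apply the span property to `(ψ, ψ, -ψ, -ψ)`: on the
slot-1 projection `I`, `ψ = αk + βω + γu + c₁`; on the OVERLAPPING slot-3 projection `I + t`,
`ψ = αk + βω - γu - c₃` ⇒ `γ = 0` (`u` strictly increasing; triage r1-3); overlapping boxes ⇒ one `(α, β, c)`
on `𝕋` minus finitely many points, smoothness across those points (`v''(k_m) ≠ 0`) or a straddling transversal
chart ⇒ everywhere; `ψ(k + 2π) = ψ(k)` ⇒ `α = 0` — the non-periodic null vector `k ↦ k` of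
`hasOddSectorGap_false_without_periodic` is exactly the relation `R_k` that periodicity removes. Leans on:
`HasStrictFDerivAt.implicitFunction` / `ImplicitFunctionData`, `hasDerivAt_dispersion`, `groupVelocity`,
`Function.Periodic`, `IsPreconnected`, S3's output shape. -/
theorem stub_gluing :
    ∀ ω₂ : ℝ, 0 < ω₂ →
      (∀ (U : Set (ℝ × ℝ)) (h : ℝ × ℝ → ℝ), IsResonanceChart ω₂ U h →
        ∀ g₁ g₂ g₃ g₄ : ℝ → ℝ, ContDiff ℝ (⊤ : ℕ∞) g₁ → ContDiff ℝ (⊤ : ℕ∞) g₂ →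
        ContDiff ℝ (⊤ : ℕ∞) g₃ → ContDiff ℝ (⊤ : ℕ∞) g₄ →
        (∀ p ∈ U, g₁ p.1 + g₂ (h p) + g₃ p.2 + g₄ (p.1 + h p - p.2) = 0) →
        ∃ α β γ c₁ c₂ c₃ c₄ : ℝ, ∀ p ∈ U,
          g₁ p.1 = α * p.1 + β * dispersion ω₂ p.1 + γ * ellipticLog ω₂ p.1 + c₁ ∧
          g₂ (h p) = α * h p + β * dispersion ω₂ (h p) + γ * ellipticLog ω₂ (h p) + c₂ ∧
          g₃ p.2 = -(α * p.2) - β * dispersion ω₂ p.2 + γ * ellipticLog ω₂ p.2 + c₃ ∧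
          g₄ (p.1 + h p - p.2) = -(α * (p.1 + h p - p.2)) - β * dispersion ω₂ (p.1 + h p - p.2) +
            γ * ellipticLog ω₂ (p.1 + h p - p.2) + c₄) →
      ∀ ψ : ℝ → ℝ, ContDiff ℝ (⊤ : ℕ∞) ψ → Function.Periodic ψ (2 * π) →
        (∀ k₁ k₂ k₃ : ℝ, resonanceFn ω₂ k₁ k₂ k₃ = 0 → 0 < velocityGap ω₂ k₁ k₂ k₃ →
          ψ k₁ + ψ k₂ = ψ k₃ + ψ (k₁ + k₂ - k₃)) →
        ∃ c d : ℝ, ∀ k : ℝ, ψ k = c + d * dispersion ω₂ k := by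
  sorry

/-- **S5 · `stub_bootstrap` — `L² → C^∞` bootstrap of null vectors** (size L; the one regularity step
common to all lines, LS08 §5 device). For `0 < ω₂`, `0 < a`, `0 ≤ b`: a `2π`-periodic measurable `f` with
`‖f‖² < ∞` and `q(f) = 0` is a.e. equal to a smooth `2π`-periodic `ψ` satisfying the collision identity at
every general-position resonance. Proof sketch: `q(f) = 0` ⇒ for a.e. `(k₁, k₃)` and every resonant `k₂`
with `w > 0` the bracket vanishes (`resonantSet_finite`; `w > 0` off the null sets `{v₂ = v₄}` (Jacobian junk)
and `{Φ = 0}` (an analytic curve at most, only if `a ≤ 4b`; `Φ ≥ a > 0` at grazing)); average the a.e.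
identity `f(k₁) = f(k₃) + f(k₄) - f(k₂)` against a bump in `k₃` over a general-position window: the changes
of variables `k₃ ↦ k₂ = h` (`∂₃h = (v₃-v₄)/(v₂-v₄) ≠ 0`) and `k₃ ↦ k₄` (`∂₃k₄ = (v₃-v₂)/(v₂-v₄) ≠ 0`) are
smooth local diffeomorphisms BY the velocity inequalities, so the right side is `C^∞` in `k₁`; such windows
exist for every `k₁` (Disproof.lean §3(C): `∂₃h` has two transversal zeros per row, `∂₃h ≠ 1` everywhere);
the smooth representative satisfies the identity at every general-position resonance by continuity (local
IFT graph), and `f = ψ` a.e. on `ℝ` by periodicity of both. `0 < b` unnecessary, `0 ≤ b` kept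
(`onsite_of_crux`). Leans on: `resonantSet_finite` (PinnedChainResonantFinite), `lintegral_eq_zero_iff'`,
`ae_restrict_iff'`, `MeasureTheory.integral_image_eq_integral_abs_deriv_smul`,
`hasFDerivAt_integral_of_dominated_of_fderiv_le`, `HasStrictFDerivAt.implicitFunction`. -/
theorem stub_bootstrap :
    ∀ ω₂ a b : ℝ, 0 < ω₂ → 0 < a → 0 ≤ b → ∀ f : ℝ → ℝ, Function.Periodic f (2 * π) →
      Measurable f → cellNormSq f < ∞ → boltzmannForm ω₂ a b f = 0 →
        ∃ ψ : ℝ → ℝ, ContDiff ℝ (⊤ : ℕ∞) ψ ∧ Function.Periodic ψ (2 * π) ∧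
          (∀ k₁ k₂ k₃ : ℝ, resonanceFn ω₂ k₁ k₂ k₃ = 0 → 0 < velocityGap ω₂ k₁ k₂ k₃ →
          ψ k₁ + ψ k₂ = ψ k₃ + ψ (k₁ + k₂ - k₃)) ∧
          f =ᵐ[volume] ψ := by
  sorry

/-- **S6 · `stub_weylReduction` — coercivity given no odd null vector** (size L analysis / XL Lean; the
"one analytic estimate left" of Disproof.lean §4; verbatim the shape `GapOfNoOddNullVector` endorsed by the
triage panel, so one proof serves every classification line). For `0 < ω₂`, `0 < a`, `0 ≤ b`: if every odd
`2π`-periodic measurable `L²` null vector of `q` has norm zero, the odd-sector gap holds. Proof sketch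
(Lukkarinen2016 §3.4 made honest; fold-jet's lsc-free architecture): suppose the odd infimum is `0`; take
odd `f_n`, `‖f_n‖ = 1`, `q(f_n) → 0`; truncate the kernel to `{velocityGap ≥ ε}`: there `|∂₂Ω| ≥ ε` and all
six change-of-variable Jacobians are ratios of velocity differences bounded above and below, so
`q ≥ q_ε = ⟨f, V_ε f⟩ - ⟨f, K_ε f⟩` (`boltzmannForm_mono_weight`) with `K_ε` Hilbert–Schmidt and
`V_ε ≥ v₀(ε) > 0` for small `ε` — HERE `0 < a` is used (every fibre keeps collisions of positive weight; at
`a = 0` the fibre `k = 0` is dead: the disprover's near-miss `not_hasOddSectorGap_zero_onsite`); a weak limit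
`f` of the `f_n` has `⟨f, K_ε f⟩ ≥ v₀ > 0`, so `f ≠ 0`, is odd periodic `L²`, and
`q_ε'(f) ≤ liminf q_ε'(f_n) ≤ liminf q(f_n) = 0` for every `ε'` (bounded non-negative forms are weakly lsc),
whence `q(f) = sup_ε' q_ε'(f) = 0` (monotone convergence) — contradicting the hypothesis. The gap constant
depends on `(ω₂, a, b)` (`no_uniform_gap`). Leans on: `MeasureTheory.Lp` / `MemLp`, weak sequential
compactness of the `L²` ball, `IsCompactOperator` (Hilbert–Schmidt), `lintegral_iSup` (monotone convergence),
`boltzmannForm_mono_weight`, `hasOddSectorGap_of_weight_le` (landed, OnsiteReduction). -/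
theorem stub_weylReduction :
    ∀ ω₂ a b : ℝ, 0 < ω₂ → 0 < a → 0 ≤ b →
      (∀ f : ℝ → ℝ, Function.Periodic f (2 * π) → Measurable f → Function.Odd f →
        cellNormSq f < ∞ → boltzmannForm ω₂ a b f = 0 → cellNormSq f = 0) →
      HasOddSectorGap ω₂ a b := by
  sorry

/-! ## Name-keyed statements of the stubs (the hypotheses of the composition, BY NAME)

`#h21_check_skeleton` admits as hypotheses of `FGRGap_of` only registered obligations / declared stubs by
name; each `Registered.stub_X : Prop` below is the statement of `stub_X` VERBATIM (same source string —
this file is generated by `gen_line.py` in the planner folder — and checked definitionally by the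
`example`s that follow). -/
namespace Registered

/-- Statement of `stub_resonanceIsChord` (verbatim), keyed by the registered stub name. -/
abbrev stub_resonanceIsChord : Prop :=
    ∀ ω₂ : ℝ, 0 < ω₂ → ∀ k₁ k₂ k₃ : ℝ, resonanceFn ω₂ k₁ k₂ k₃ = 0 →
      (∀ n : ℤ, k₃ - k₁ ≠ 2 * π * n) → (∀ n : ℤ, k₃ - k₂ ≠ 2 * π * n) →
        det3 (phononPoint ω₂ k₁) (phononPoint ω₂ k₂) (-(phononPoint ω₂ k₃)) = 0

/-- Statement of `stub_antiInvariant_of_chord` (verbatim), keyed by the registered stub name. -/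
abbrev stub_antiInvariant_of_chord : Prop :=
    ∀ ω₂ : ℝ, 0 < ω₂ →
      (∀ k₁ k₂ k₃ : ℝ, resonanceFn ω₂ k₁ k₂ k₃ = 0 →
        (∀ n : ℤ, k₃ - k₁ ≠ 2 * π * n) → (∀ n : ℤ, k₃ - k₂ ≠ 2 * π * n) →
          det3 (phononPoint ω₂ k₁) (phononPoint ω₂ k₂) (-(phononPoint ω₂ k₃)) = 0) →
      ∀ (U : Set (ℝ × ℝ)) (h : ℝ × ℝ → ℝ), IsResonanceChart ω₂ U h →
        ∃ C : ℝ, ∀ p ∈ U,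
          ellipticLog ω₂ p.1 + ellipticLog ω₂ (h p) + ellipticLog ω₂ p.2 +
            ellipticLog ω₂ (p.1 + h p - p.2) = C

/-- Statement of `stub_abelBolSpan` (verbatim), keyed by the registered stub name. -/
abbrev stub_abelBolSpan : Prop :=
    ∀ ω₂ : ℝ, 0 < ω₂ → ∀ (U : Set (ℝ × ℝ)) (h : ℝ × ℝ → ℝ), IsResonanceChart ω₂ U h →
      (∃ C : ℝ, ∀ p ∈ U,
          ellipticLog ω₂ p.1 + ellipticLog ω₂ (h p) + ellipticLog ω₂ p.2 +
            ellipticLog ω₂ (p.1 + h p - p.2) = C) →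
      ∀ g₁ g₂ g₃ g₄ : ℝ → ℝ, ContDiff ℝ (⊤ : ℕ∞) g₁ → ContDiff ℝ (⊤ : ℕ∞) g₂ →
        ContDiff ℝ (⊤ : ℕ∞) g₃ → ContDiff ℝ (⊤ : ℕ∞) g₄ →
        (∀ p ∈ U, g₁ p.1 + g₂ (h p) + g₃ p.2 + g₄ (p.1 + h p - p.2) = 0) →
        ∃ α β γ c₁ c₂ c₃ c₄ : ℝ, ∀ p ∈ U,
          g₁ p.1 = α * p.1 + β * dispersion ω₂ p.1 + γ * ellipticLog ω₂ p.1 + c₁ ∧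
          g₂ (h p) = α * h p + β * dispersion ω₂ (h p) + γ * ellipticLog ω₂ (h p) + c₂ ∧
          g₃ p.2 = -(α * p.2) - β * dispersion ω₂ p.2 + γ * ellipticLog ω₂ p.2 + c₃ ∧
          g₄ (p.1 + h p - p.2) = -(α * (p.1 + h p - p.2)) - β * dispersion ω₂ (p.1 + h p - p.2) +
            γ * ellipticLog ω₂ (p.1 + h p - p.2) + c₄

/-- Statement of `stub_gluing` (verbatim), keyed by the registered stub name. -/
abbrev stub_gluing : Prop :=
    ∀ ω₂ : ℝ, 0 < ω₂ →
      (∀ (U : Set (ℝ × ℝ)) (h : ℝ × ℝ → ℝ), IsResonanceChart ω₂ U h →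
        ∀ g₁ g₂ g₃ g₄ : ℝ → ℝ, ContDiff ℝ (⊤ : ℕ∞) g₁ → ContDiff ℝ (⊤ : ℕ∞) g₂ →
        ContDiff ℝ (⊤ : ℕ∞) g₃ → ContDiff ℝ (⊤ : ℕ∞) g₄ →
        (∀ p ∈ U, g₁ p.1 + g₂ (h p) + g₃ p.2 + g₄ (p.1 + h p - p.2) = 0) →
        ∃ α β γ c₁ c₂ c₃ c₄ : ℝ, ∀ p ∈ U,
          g₁ p.1 = α * p.1 + β * dispersion ω₂ p.1 + γ * ellipticLog ω₂ p.1 + c₁ ∧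
          g₂ (h p) = α * h p + β * dispersion ω₂ (h p) + γ * ellipticLog ω₂ (h p) + c₂ ∧
          g₃ p.2 = -(α * p.2) - β * dispersion ω₂ p.2 + γ * ellipticLog ω₂ p.2 + c₃ ∧
          g₄ (p.1 + h p - p.2) = -(α * (p.1 + h p - p.2)) - β * dispersion ω₂ (p.1 + h p - p.2) +
            γ * ellipticLog ω₂ (p.1 + h p - p.2) + c₄) →
      ∀ ψ : ℝ → ℝ, ContDiff ℝ (⊤ : ℕ∞) ψ → Function.Periodic ψ (2 * π) →
        (∀ k₁ k₂ k₃ : ℝ, resonanceFn ω₂ k₁ k₂ k₃ = 0 → 0 < velocityGap ω₂ k₁ k₂ k₃ →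
          ψ k₁ + ψ k₂ = ψ k₃ + ψ (k₁ + k₂ - k₃)) →
        ∃ c d : ℝ, ∀ k : ℝ, ψ k = c + d * dispersion ω₂ k

/-- Statement of `stub_bootstrap` (verbatim), keyed by the registered stub name. -/
abbrev stub_bootstrap : Prop :=
    ∀ ω₂ a b : ℝ, 0 < ω₂ → 0 < a → 0 ≤ b → ∀ f : ℝ → ℝ, Function.Periodic f (2 * π) →
      Measurable f → cellNormSq f < ∞ → boltzmannForm ω₂ a b f = 0 →
        ∃ ψ : ℝ → ℝ, ContDiff ℝ (⊤ : ℕ∞) ψ ∧ Function.Periodic ψ (2 * π) ∧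
          (∀ k₁ k₂ k₃ : ℝ, resonanceFn ω₂ k₁ k₂ k₃ = 0 → 0 < velocityGap ω₂ k₁ k₂ k₃ →
          ψ k₁ + ψ k₂ = ψ k₃ + ψ (k₁ + k₂ - k₃)) ∧
          f =ᵐ[volume] ψ

/-- Statement of `stub_weylReduction` (verbatim), keyed by the registered stub name. -/
abbrev stub_weylReduction : Prop :=
    ∀ ω₂ a b : ℝ, 0 < ω₂ → 0 < a → 0 ≤ b →
      (∀ f : ℝ → ℝ, Function.Periodic f (2 * π) → Measurable f → Function.Odd f →
        cellNormSq f < ∞ → boltzmannForm ω₂ a b f = 0 → cellNormSq f = 0) →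
      HasOddSectorGap ω₂ a b

end Registered

/-! ### Consistency: each registered statement IS its stub's type (definitionally) -/

example : Registered.stub_resonanceIsChord := stub_resonanceIsChord
example : Registered.stub_antiInvariant_of_chord := stub_antiInvariant_of_chord
example : Registered.stub_abelBolSpan := stub_abelBolSpan
example : Registered.stub_gluing := stub_gluing
example : Registered.stub_bootstrap := stub_bootstrap
example : Registered.stub_weylReduction := stub_weylReduction

/-! ## The kernel-checked composition -/

/-- **Composition `FGRGap_of`.** S1 → S2 → S3 → S4 → S5 → S6 → `FGRGap` (sorry-free; concludes the
route decl BY NAME; hypotheses are the registered stubs BY NAME). Logic: fix `ω₂, a, b > 0`; by S6 it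
suffices that odd periodic `L²` null vectors of `q` are null; S5 replaces such an `f` a.e. by a smooth
periodic `ψ` invariant at general-position resonances; S4, fed the chartwise span property assembled from
S3 ∘ S2 ∘ S1, gives `ψ = c + dω` (even); `f` odd, `f =ᵐ ψ`, `ψ` continuous and Lebesgue measure
negation-invariant ⇒ `ψ` odd ⇒ `ψ ≡ 0` ⇒ `‖f‖² = 0`. -/
theorem FGRGap_of (h1 : Registered.stub_resonanceIsChord) (h2 : Registered.stub_antiInvariant_of_chord)
    (h3 : Registered.stub_abelBolSpan) (h4 : Registered.stub_gluing) (h5 : Registered.stub_bootstrap)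
    (h6 : Registered.stub_weylReduction) :
    Summit.AtomisticToContinuum.FouriersLaw.Theses.EmbeddedDrudeMourre.FGRGap := by
  intro ω₂ a b hω ha hb
  refine h6 ω₂ a b hω ha hb.le ?_
  intro f hper hmeas hodd hfin hq
  obtain ⟨ψ, hψs, hψp, hψinv, hfψ⟩ := h5 ω₂ a b hω ha hb.le f hper hmeas hfin hq
  -- the chartwise span property, assembled from S3 ∘ S2 ∘ S1, fed to the gluing S4
  obtain ⟨c, d, hcd⟩ := h4 ω₂ hω
    (fun U h hc => h3 ω₂ hω U h hc (h2 ω₂ hω (h1 ω₂ hω) U h hc)) ψ hψs hψp hψinv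
  -- ψ = c + dω is even and continuous
  have hψc : Continuous ψ := hψs.continuous
  have hψeven : ∀ k, ψ (-k) = ψ k := fun k => by rw [hcd (-k), hcd k, dispersion_neg]
  -- ψ is odd: f odd, f =ᵐ ψ, negation preserves Lebesgue measure, ψ continuous
  have hneg : (fun k => f (-k)) =ᵐ[volume] (fun k => ψ (-k)) :=
    (Measure.measurePreserving_neg (volume : Measure ℝ)).quasiMeasurePreserving.ae_eq_comp hfψ
  have hA : (fun k => ψ (-k)) =ᵐ[volume] (fun k => -ψ k) := by
    have h1' : (fun k => f (-k)) = fun k => -f k := funext fun k => hodd k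
    have h2' : (fun k => -f k) =ᵐ[volume] (fun k => -ψ k) := by
      filter_upwards [hfψ] with k hk
      simp [hk]
    rw [h1'] at hneg
    exact hneg.symm.trans h2'
  have hψodd : ∀ k, ψ (-k) = -ψ k := fun k =>
    congr_fun ((Continuous.ae_eq_iff_eq volume (hψc.comp continuous_neg) hψc.neg).1 hA) k
  have hψ0 : ∀ k, ψ k = 0 := fun k => by linarith [hψeven k, hψodd k]
  -- hence f = 0 a.e. and ‖f‖² = 0
  have hf0 : ∀ᵐ k ∂volume, f k = 0 := by
    filter_upwards [hfψ] with k hk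
    rw [hk, hψ0 k]
  unfold cellNormSq
  have hint : (fun k => ENNReal.ofReal (f k ^ 2)) =ᵐ[volume.restrict (Ioc (-π) π)] fun _ => 0 := by
    filter_upwards [ae_restrict_of_ae (s := Ioc (-π) π) hf0] with k hk
    simp [hk]
  rw [lintegral_congr_ae hint, lintegral_zero]

/-- Certificate that the six registered stubs (with their explicit signatures) feed the composition:
the crux modulo exactly the stubs (an `example`, not a theorem: it depends on the stubs' `sorry`s). -/
example : Summit.AtomisticToContinuum.FouriersLaw.Theses.EmbeddedDrudeMourre.FGRGap :=
  FGRGap_of stub_resonanceIsChord stub_antiInvariant_of_chord stub_abelBolSpan stub_gluing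
    stub_bootstrap stub_weylReduction

/-! ## Checks against the landed Negative lemmas (Disproof honoured) -/

/-- The hypotheses `0 < a`, `f` periodic, `f` odd carried by S5/S6 are exactly the load-bearing ones:
without periodicity `k ↦ k` (the abelian relation `R_k` of S3!) is a null vector — -/
example (ω₂ a b : ℝ) : boltzmannForm ω₂ a b (fun k => k) = 0 :=
  Summit.AtomisticToContinuum.FouriersLaw.Theorems.FGRGap.Negative.LoadBearing.boltzmannForm_id ω₂ a b

/-- — without oddness the even invariants `1, ω` (the relation `R_ω`, and the constants of S3) are null
vectors, which is why S4 classifies ALL smooth invariants as `c + dω` and `FGRGap_of` kills them by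
oddness only at the end — -/
example (ω₂ a b c d : ℝ) : boltzmannForm ω₂ a b (fun k => c + d * dispersion ω₂ k) = 0 :=
  boltzmannForm_const_add_mul_dispersion ω₂ a b c d

/-- — and the couplings enter S6 through `0 < a` alone (`0 ≤ b`): consistent with `onsite_of_crux`
(the `b = 0` gap is necessary) and with the harmonic kill `crux_false_without_couplings`. -/
example : ¬ ∀ ω₂ a b : ℝ, 0 < ω₂ → HasOddSectorGap ω₂ a b :=
  Summit.AtomisticToContinuum.FouriersLaw.Theorems.FGRGap.Negative.LoadBearing.crux_false_without_couplings

/-- The crux implies the hypothesis-free conclusion of S6 at every `0 < b` (so S6 is not stronger than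
needed there) and, by the landed `onsite_of_crux`, the `b = 0` instance that S5/S6 also cover. -/
example (h : Summit.AtomisticToContinuum.FouriersLaw.Theses.EmbeddedDrudeMourre.FGRGap) {ω₂ : ℝ}
    (hω : 0 < ω₂) : HasOddSectorGap ω₂ 1 0 :=
  Summit.AtomisticToContinuum.FouriersLaw.Theorems.FGRGap.Negative.OnsiteReduction.onsite_of_crux h hω

end Summit.AtomisticToContinuum.FouriersLaw.Cruxes.FGRGap.ChordQuarticAbel

end
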